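import Summits.BirchSwinnertonDyer.Rank1Residual.AdditivePotMult.RankZeroIndexBound
import Summits.BirchSwinnertonDyer.Rank1Residual.X11b.TwistTransportIrr
import Literature.NumberTheory.EllipticCurves.Rank1Residual.Typed.SelmerCardCertificateRankZero
import Literature.NumberTheory.EllipticCurves.NonEisensteinPrimeOfSurjective
import HarnessLib

/-!
# O6/O5 rank one, `t = 0`: the TWIST-DESCENT certificate — the partner's Heegner INDEX bound
# `ord_p [E(K):ℤy_K] ≤ k` plus a `p`-descent certificate on the rank-`0` Heegner TWIST `E^{(d_K)}`
# close the `p`-part of BSD for the twist (`#Ш = p^{2k}`) AND force `Ш(E)[p^∞] = 0`, at ANY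
# reduction type at `p` (cell `b2b-bsdres`, team o5o6, seat O6 planner 2 = `b2b-bsdres-o6-r2`,
# gen 36; BOOKKEEPING THEOREMS over the tree's named facts; nothing asserted, nothing booked)

HONEST FRAMING (cell `b2b-bsdres`, verbatim): research routes; no claim beyond stated classes;
census output = EVIDENCE / conjecture items, never a Literature fact. This file adds NO conjecture
and NO Literature fact. It is the MIRROR of the cell's E-side certificates
(`AdditivePotMult/RankOneShaCertificate.lean`: certificate `p^{2k−1} ∣ #Ш(E)` on the rank-ONE
curve, unit twist value; `AdditivePotMult/RankZeroIndexBound.lean`: index bound and certificate on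
the SAME rank-`0` curve; `X4/KolyvaginSqueeze.lean` (unit `b2b-bsdres-sha-2`, GEN 13): the same
two-curve inequality `padicValNat_sha_add_twist_le_of_kolyvagin_index` — finiteness there from
Gross–Zagier–Kolyvagin for both curves, here from `kolyvagin` over `K` alone — with the certificate
then placed on `E` and the twist's `Ш[p] = 0` as by-product,
`padicValNat_sha_twist_eq_zero_of_kolyvagin_index_of_pow_dvd`): here the Kolyvagin INDEX bound is
certified on the rank-one curve `E`
over its Heegner field `K` and the DESCENT certificate lives on the rank-ZERO twist `E^{(d_K)}` —
which is the shape of every `t = 0` row of the o5o6 census of record (`cells/o5o6/TARGETS.md` §O6,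
route R-O6-C0): `ord₃ [E(K):ℤy_K] = 1` certified by two engines on every Heegner field, and
`#Ш(E^{(d_K)})_an = 9`.

THE ARGUMENT (all steps are tree theorems; the two deep inputs are the tree's NAMED FACTS
`kolyvagin` — `Ш(E/K)` finite — and `Kolyvagin1990_padicValNat_card_sha_le` —
`ord_p #Ш(E/K) ≤ 2·ord_p [E(K):ℤy_K]` for `p` odd with `ρ̄_{E,p}` onto, NO hypothesis on the
reduction of `E` at `p`, no Manin constant, no Tamagawa condition):
`ord_p #Ш(E/K) = ord_p #Ш(E) + ord_p #Ш(E^{(d_K)})` for odd `p` (Dokchitser–Dokchitser 2010,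
Lemma 4.14; tree `AdditivePotMult.padicValNat_shaOrder_baseChange`), so the index bound gives
`ord_p #Ш(E) + ord_p #Ш(E^{(d_K)}) ≤ 2k` (§1); a certificate `p^{2k−1} ∣ #Ш(E^{(d_K)})` and
Cassels–Tate squareness give `2k ≤ ord_p #Ш(E^{(d_K)})` (tree
`Typed.missingLowerBoundAt_of_casselsTate_of_pow_dvd`), hence `ord_p #Ш(E^{(d_K)}) = 2k`,
`ord_p #Ш(E) = 0`, and `BSD(E^{(d_K)}, p)` when `ord_p #Ш(E^{(d_K)})_an = 2k` (§2); in the census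
currency `k = 1` the certificate is "`Sel^{(p)}(E^{(d_K)}/ℚ) ≠ 0`" (rank `0`, `E^{(d_K)}[p]`
irreducible — transported from `ρ̄_{E,p}` onto by the tree's
`X11b.hasIrreducibleModPGaloisRep_twist_model` — and the PROVED exact sequence
`0 → E(ℚ)/p → Sel^{(p)} → Ш[p] → 0`, tree `Typed.exists_sha_torsion_of_pow_rank_lt_card_selmerGroup`),
and `BSD(E, p)` follows too when `#Ш(E)_an` is a `p`-adic unit (§3).

EVIDENCE, NOT INPUT (kit jobs j228009 / j228010, unit gen 36, prereg PREREG-G36-1 sha256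
8039d33f…; engine = x11b's Schaefer–Stoll `3`-descent `desc3lib.gp` rev h1, byte-identical): on all
`437` Heegner twists `E^{(D)}` of the `195` additive-`3` rank-one window rows (`129` wild, `66` tame;
`N < 2·10⁴`), `dim_{𝔽₃} Sel^{(3)}(E^{(D)}/ℚ) = 2·(ord₃ [E(K):ℤy_K] − t)` as BSD predicts
(`436` MATCH + `1` MATCH at `(ℤ/9)²`, `0` DIFF; the listed Selmer elements are exact, so the LOWER
bound `dim ≥ 2` on the `79` `t = 0` pairs — `31` wild — is unconditional; equality is GRH-conditional).
With the census index records (`ord₃ = 1`) and `surj(3)`, §3 closes, PER PAIR and granted the named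
facts, `BSD(E^{(D)},3)` with `Ш(E^{(D)})[3^∞]` of order `9` for those `79` rank-`0` additive-`3`
curves — all of conductor `N·D² > 5·10⁵`, i.e. BEYOND the census window: a demonstration of route
R-O6-C0's CONCLUSION without a derived Kolyvagin class, not a booking. Nothing in-window changes.

References: [McCallumLMS1991] §1 Theorem (Kolyvagin); [GrossLMS1991] Thm. 1.3; [Kolyvagin1990]
Thm. A; [DokchitserDokchitserAnnals2010] Lemma 4.14; [SilvermanAEC2009] X.4.2(a), X.4.14, X.5
Cor. 5.4; [Miller2011LMS] Def. 1.1; [SchaeferStoll2004] (the `3`-descent behind the certificates).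
-/

noncomputable section

open scoped Classical NumberField

open WeierstrassCurve NumberField Literature.NumberTheory.EllipticCurves
  Literature.NumberTheory.EllipticCurves.Rank1Residual
  Literature.NumberTheory.EllipticCurves.Rank1Residual.Typed
  Summit.BirchSwinnertonDyer.Rank1Residual.AdditivePotMult

namespace Summit.BirchSwinnertonDyer.Rank1Residual.AdditiveThree

/-! ### §1 Data level: the partner's index bound caps `Ш` of BOTH curves (any rank, any odd `p`) -/

/-- **`ord_p #Ш(E) + ord_p #Ш(E^{(d_K)}) ≤ 2k` from ONE Heegner field with
`ord_p [E(K):ℤP] ≤ k`**, for `p` odd with `ρ̄_{E,p}` onto, ANY reduction type of `E` at `p`, and any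
`ℚ`-model `Wd` of the twist `E^{(d_K)}`; both `Ш(E)` and `Ш(Wd)` are finite. Kolyvagin's
finiteness (`hKo`) and inequality (`hB`) over `K`, descended by the odd-`p` decomposition
`ord_p #Ш(E/K) = ord_p #Ш(E) + ord_p #Ш(E^{(d_K)})`. Per pair; nothing booked.
[cite: McCallumLMS1991, §1 Theorem (Kolyvagin), p. 296] [cite: GrossLMS1991, Thm. 1.3]
[cite: DokchitserDokchitserAnnals2010, Lemma 4.14] -/
theorem shaFinite_and_padicValNat_shaOrder_add_twist_le_of_indexBound
    (W : WeierstrassCurve ℚ) [W.IsElliptic] (p : ℕ) [Fact p.Prime]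
    {N : ℕ} [NeZero N] {K : Type} [Field K] [NumberField K]
    (hKo : kolyvagin N W K) (hB : Kolyvagin1990_padicValNat_card_sha_le N W K)
    (hK : IsImaginaryQuadratic K) (hH : SatisfiesHeegnerHypothesis N K)
    {P : (W.baseChange K).toAffine.Point} (hP : IsHeegnerPoint N W K P) (hnt : ¬ IsOfFinAddOrder P)
    (hp2 : p ≠ 2) (hsurj : Surj W p) {k : ℕ}
    (hI : padicValNat p (AddSubgroup.zmultiples P).index ≤ k)
    (Wd : WeierstrassCurve ℚ) [Wd.IsElliptic]
    (hWd : ∃ C : VariableChange ℚ, C • W.quadraticTwist (NumberField.discr K : ℚ) = Wd) :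
    W.ShaFinite ∧ Wd.ShaFinite ∧
      padicValNat p W.shaOrder + padicValNat p Wd.shaOrder ≤ 2 * k := by
  have hp : p.Prime := Fact.out
  obtain ⟨-, hfinK⟩ := hKo hK hH hP hnt
  obtain ⟨C, hC⟩ := hWd
  have hW' : (1 : VariableChange K) • W.baseChange K = W.baseChange K := one_smul _ _
  haveI : (W.baseChange K).IsElliptic := by rw [WeierstrassCurve.baseChange]; infer_instance
  have hfinW : W.ShaFinite := W.shaFinite_of_shaFinite_smul_baseChange K hW' hfinK
  have hfinD : Wd.ShaFinite := W.shaFinite_twist_of_shaFinite_smul_baseChange K hK.1 hC hW' hfinK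
  -- `ord_p #Ш(E/K) = ord_p #Ш(E) + ord_p #Ш(Wd)`
  have hsum := padicValNat_shaOrder_baseChange W p K Wd (W.baseChange K) hp2 hK.1 ⟨C, hC⟩ ⟨1, hW'⟩
    hfinW hfinD hfinK
  -- Kolyvagin's bound over `K`
  have hbound := hB hK hH hP hnt hp hp2 hsurj
  have hK' : padicValNat p (W.baseChange K).shaOrder ≤ 2 * k := by
    unfold WeierstrassCurve.shaOrder
    exact hbound.trans (Nat.mul_le_mul_left 2 hI)
  exact ⟨hfinW, hfinD, by omega⟩

/-- **The typed UPPER half for the TWIST, `ord_p #Ш(E^{(d_K)}) ≤ ord_p #Ш(E^{(d_K)})_an`, from the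
partner's index bound** (same data; `#Ш(Wd)_an = q_d ∈ ℚ` with `2k ≤ ord_p q_d`). Per pair.
[cite: McCallumLMS1991, §1 Theorem (Kolyvagin), p. 296] [cite: Miller2011LMS, Def. 1.1] -/
theorem missingUpperBoundAt_twist_of_indexBound
    (W : WeierstrassCurve ℚ) [W.IsElliptic] (p : ℕ) [Fact p.Prime]
    {N : ℕ} [NeZero N] {K : Type} [Field K] [NumberField K]
    (hKo : kolyvagin N W K) (hB : Kolyvagin1990_padicValNat_card_sha_le N W K)
    (hK : IsImaginaryQuadratic K) (hH : SatisfiesHeegnerHypothesis N K)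
    {P : (W.baseChange K).toAffine.Point} (hP : IsHeegnerPoint N W K P) (hnt : ¬ IsOfFinAddOrder P)
    (hp2 : p ≠ 2) (hsurj : Surj W p) {k : ℕ}
    (hI : padicValNat p (AddSubgroup.zmultiples P).index ≤ k)
    (Wd : WeierstrassCurve ℚ) [Wd.IsElliptic]
    (hWd : ∃ C : VariableChange ℚ, C • W.quadraticTwist (NumberField.discr K : ℚ) = Wd)
    {qd : ℚ} (hqd : shaAn Wd = (qd : ℂ)) (hvd : (2 * k : ℤ) ≤ padicValRat p qd) :
    MissingUpperBoundAt Wd p := by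
  obtain ⟨-, -, hle⟩ := shaFinite_and_padicValNat_shaOrder_add_twist_le_of_indexBound W p hKo hB hK
    hH hP hnt hp2 hsurj hI Wd hWd
  refine ⟨qd, hqd, le_trans ?_ hvd⟩
  have : padicValNat p Wd.shaOrder ≤ 2 * k := by omega
  exact_mod_cast this

/-! ### §2 The twist's `p`-part of BSD and `Ш(E)[p^∞] = 0` from a certificate ON THE TWIST -/

/-- **Rank-`0` twist, ANY odd `p`, `ρ̄_{E,p}` onto, `ord_p #Ш(E^{(d_K)})_an = 2k`: the partner's
index bound `ord_p [E(K):ℤP] ≤ k` (upper half) and the descent certificate `p^{2k−1} ∣ #Ш(E^{(d_K)})`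
(lower half, Cassels–Tate squareness `hCT`) give `BSD(E^{(d_K)}, p)` AND `ord_p #Ш(E) = 0`.**
`Ш` finite by Kolyvagin over `K`; `rank E^{(d_K)}(ℚ) = 0` by Gross–Zagier–Kolyvagin (`hGZK`). The
twist-side twin of `AdditivePotMult.bsdp_rankZero_of_indexBound_of_pow_dvd` (index and
certificate there on the same curve). Per pair; nothing booked.
[cite: McCallumLMS1991, §1 Theorem (Kolyvagin), p. 296] [cite: SilvermanAEC2009, Thm. X.4.14]
[cite: Miller2011LMS, §1 and Def. 1.1] -/
theorem bsdp_twist_and_padicValNat_shaOrder_eq_zero_of_indexBound_of_pow_dvd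
    (W : WeierstrassCurve ℚ) [W.IsElliptic] (p : ℕ) [Fact p.Prime]
    (hCT : exists_casselsTate_pairing (K := ℚ)) (hGZK : rank_eq_analyticRank_of_analyticRank_le_one)
    {N : ℕ} [NeZero N] {K : Type} [Field K] [NumberField K]
    (hKo : kolyvagin N W K) (hB : Kolyvagin1990_padicValNat_card_sha_le N W K)
    (hK : IsImaginaryQuadratic K) (hH : SatisfiesHeegnerHypothesis N K)
    {P : (W.baseChange K).toAffine.Point} (hP : IsHeegnerPoint N W K P) (hnt : ¬ IsOfFinAddOrder P)
    (hp2 : p ≠ 2) (hsurj : Surj W p) {k : ℕ}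
    (hI : padicValNat p (AddSubgroup.zmultiples P).index ≤ k)
    (Wd : WeierstrassCurve ℚ) [Wd.IsElliptic]
    (hWd : ∃ C : VariableChange ℚ, C • W.quadraticTwist (NumberField.discr K : ℚ) = Wd)
    (hrd : Wd.analyticRank = 0)
    {qd : ℚ} (hqd : shaAn Wd = (qd : ℂ)) (hvd : padicValRat p qd = 2 * k)
    (hdvd : p ^ (2 * k - 1) ∣ Wd.shaOrder) :
    BSDp Wd p ∧ padicValNat p W.shaOrder = 0 := by
  obtain ⟨-, hfinD, hle⟩ := shaFinite_and_padicValNat_shaOrder_add_twist_le_of_indexBound W p hKo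
    hB hK hH hP hnt hp2 hsurj hI Wd hWd
  -- lower half on the twist: Cassels–Tate squareness and the certificate
  obtain ⟨q', hq', hlow⟩ :=
    missingLowerBoundAt_of_casselsTate_of_pow_dvd Wd p hCT hfinD hqd (k := k) (le_of_eq hvd) hdvd
  have hqq : q' = qd := by exact_mod_cast hq'.symm.trans hqd
  subst hqq
  have h2k : 2 * k ≤ padicValNat p Wd.shaOrder := by
    have h : (2 * (k : ℤ)) ≤ (padicValNat p Wd.shaOrder : ℤ) := by rw [← hvd]; exact hlow
    exact_mod_cast h
  refine ⟨bsdp_of_missingPPartAt Wd p hGZK (by rw [hrd]; norm_num) ⟨q', hq', le_antisymm hlow ?_⟩,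
    by omega⟩
  rw [hvd]
  have : padicValNat p Wd.shaOrder ≤ 2 * k := by omega
  exact_mod_cast this

/-! ### §3 The census currency (`k = 1`): index `ord_p = 1` on `E/K`, `Sel^{(p)}(E^{(d_K)}) ≠ 0` -/

/-- **The `t = 0` pair of the o5o6 census, class-agnostic form.** `E/ℚ` with `ρ̄_{E,p}` onto
(`p` odd), `K` a Heegner field for the level `N`, `P ∈ E(K)` a Heegner point of infinite order with
`ord_p [E(K):ℤP] ≤ 1` (two-engine census index record), `Wd` any `ℚ`-model of `E^{(d_K)}` with
`r_an(Wd) = 0` and `ord_p #Ш(Wd)_an = 2`, and the twist-descent certificate `#Sel^{(p)}(Wd/ℚ) > 1`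
(one exact Selmer element; `Wd[p]` is irreducible because `E[p]` is, so `p ∤ #Wd(ℚ)_tors` and the
element maps to `Ш(Wd)[p] ∖ 0`) ⟹ **`BSD(Wd, p)` and `ord_p #Ш(E) = 0`**; if moreover
`r_an(E) ≤ 1` and `#Ш(E)_an` is a `p`-adic unit, **`BSD(E, p)`** as well. Granted the named facts
`hKo`, `hB`, `hCT`, `hGZK`. Per pair; nothing booked; the twists met in the census lie beyond its
conductor window. [cite: McCallumLMS1991, §1 Theorem (Kolyvagin), p. 296]
[cite: SilvermanAEC2009, Thm X.4.2(a)] [cite: SilvermanAEC2009, Thm. X.4.14]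
[cite: Miller2011LMS, §1 and Def. 1.1] -/
theorem bsdp_twist_and_bsdp_of_indexBound_of_one_lt_card_selmerGroup_twist
    (W : WeierstrassCurve ℚ) [W.IsElliptic] (p : ℕ) [Fact p.Prime]
    (hCT : exists_casselsTate_pairing (K := ℚ)) (hGZK : rank_eq_analyticRank_of_analyticRank_le_one)
    {N : ℕ} [NeZero N] {K : Type} [Field K] [NumberField K]
    (hKo : kolyvagin N W K) (hB : Kolyvagin1990_padicValNat_card_sha_le N W K)
    (hK : IsImaginaryQuadratic K) (hH : SatisfiesHeegnerHypothesis N K)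
    {P : (W.baseChange K).toAffine.Point} (hP : IsHeegnerPoint N W K P) (hnt : ¬ IsOfFinAddOrder P)
    (hp2 : p ≠ 2) (hsurj : Surj W p)
    (hI : padicValNat p (AddSubgroup.zmultiples P).index ≤ 1)
    (Wd : WeierstrassCurve ℚ) [Wd.IsElliptic]
    (hWd : ∃ C : VariableChange ℚ, C • W.quadraticTwist (NumberField.discr K : ℚ) = Wd)
    (hrd : Wd.analyticRank = 0)
    {qd : ℚ} (hqd : shaAn Wd = (qd : ℂ)) (hvd : padicValRat p qd = 2)
    (hSel : 1 < Nat.card (Wd.selmerGroup (p : ℤ))) :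
    (BSDp Wd p ∧ padicValNat p W.shaOrder = 0) ∧
      (W.analyticRank ≤ 1 → ∀ q : ℚ, shaAn W = (q : ℂ) → padicValRat p q = 0 → BSDp W p) := by
  have hp : p.Prime := Fact.out
  -- `Wd[p]` irreducible, hence no rational `p`-torsion on the twist
  obtain ⟨C, hC⟩ := hWd
  haveI : NeZero (p : ℚ) := ⟨by exact_mod_cast hp.ne_zero⟩
  have hirr : W.HasIrreducibleModPGaloisRep p :=
    hasIrreducibleModPGaloisRep_of_hasSurjectiveModNGaloisRep W p hsurj
  have hirrd : Wd.HasIrreducibleModPGaloisRep p :=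
    X11b.hasIrreducibleModPGaloisRep_twist_model W p K hK.1 hirr C hC
  have htors : ¬ p ∣ Wd.torsionOrder := by
    intro hdvd
    have h0 := padicValNat_torsionOrder_eq_zero_of_irreducible Wd p hirrd
    rw [padicValNat.eq_zero_iff] at h0
    rcases h0 with h | h | h
    · exact hp.one_lt.ne' h
    · exact Wd.torsionOrder_pos_holds.ne' h
    · exact h hdvd
  -- rank `0` on the twist (Gross–Zagier–Kolyvagin) and the Selmer certificate ⟹ `Ш(Wd)[p] ≠ 0`
  have hrank : Wd.mordellWeilRank = 0 := (hGZK Wd (by rw [hrd]; norm_num)).1.trans hrd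
  have htor : ∃ x : Wd.sha, x ≠ 0 ∧ p • x = 0 :=
    exists_sha_torsion_of_pow_rank_lt_card_selmerGroup Wd p hrank htors (by simpa using hSel)
  have hmain := bsdp_twist_and_padicValNat_shaOrder_eq_zero_of_indexBound_of_pow_dvd W p hCT hGZK
    hKo hB hK hH hP hnt hp2 hsurj (k := 1) hI Wd ⟨C, hC⟩ hrd hqd (by rw [hvd]; norm_num)
    (by simpa using dvd_shaOrder_of_exists_torsion Wd p htor)
  refine ⟨hmain, fun hr q hq hv => ?_⟩
  -- `E`: `ord_p #Ш(E) = 0 = ord_p #Ш(E)_an`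
  refine bsdp_of_missingPPartAt W p hGZK hr ⟨q, hq, ?_⟩
  rw [hv, hmain.2]; norm_num

/-! ### §4 The `p = 3` reading for the o5o6 `t = 0` rows -/

/-- **O6/O5 `t = 0` pair at `p = 3`.** `E` rank-one additive at `3` (wild or tame — unused by the
proof, the lever is class-agnostic), `ρ̄_{E,3}` onto, Heegner field `K` with two-engine index record
`ord₃ [E(K):ℤy_K] ≤ 1`, `#Ш(E)_an` a `3`-adic unit; twist model `Wd` of `E^{(d_K)}` with
`r_an = 0`, `ord₃ #Ш(Wd)_an = 2` and ONE exact `3`-Selmer element (`#Sel^{(3)}(Wd/ℚ) > 1`, the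
SEL3-TWIST certificate) ⟹ `BSD(E,3)`, `BSD(Wd,3)`, `Ш(E)[3^∞] = 0` (as `ord₃ #Ш(E) = 0`). This is
route R-O6-C0's conclusion for the pair WITHOUT a derived Kolyvagin class: the lower half comes from
descent on the twist instead of Kolyvagin's structure theorem. Per pair, granted `hKo`/`hB`/`hCT`/
`hGZK`; nothing booked (the `79` census twists have conductor `> 5·10⁵`).
[cite: McCallumLMS1991, §1 Theorem (Kolyvagin), p. 296] [cite: SilvermanAEC2009, Thm X.4.2(a)]
[cite: Miller2011LMS, §1 and Def. 1.1] -/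
theorem bsdp_three_pair_of_indexBound_of_one_lt_card_selmerThree_twist [Fact (Nat.Prime 3)]
    (W : WeierstrassCurve ℚ) [W.IsElliptic]
    (hCT : exists_casselsTate_pairing (K := ℚ)) (hGZK : rank_eq_analyticRank_of_analyticRank_le_one)
    {N : ℕ} [NeZero N] {K : Type} [Field K] [NumberField K]
    (hKo : kolyvagin N W K) (hB : Kolyvagin1990_padicValNat_card_sha_le N W K)
    (hK : IsImaginaryQuadratic K) (hH : SatisfiesHeegnerHypothesis N K)
    {P : (W.baseChange K).toAffine.Point} (hP : IsHeegnerPoint N W K P) (hnt : ¬ IsOfFinAddOrder P)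
    (hsurj : Surj W 3) (hI : padicValNat 3 (AddSubgroup.zmultiples P).index ≤ 1)
    (hr : W.analyticRank ≤ 1) {q : ℚ} (hq : shaAn W = (q : ℂ)) (hv : padicValRat 3 q = 0)
    (Wd : WeierstrassCurve ℚ) [Wd.IsElliptic]
    (hWd : ∃ C : VariableChange ℚ, C • W.quadraticTwist (NumberField.discr K : ℚ) = Wd)
    (hrd : Wd.analyticRank = 0) {qd : ℚ} (hqd : shaAn Wd = (qd : ℂ)) (hvd : padicValRat 3 qd = 2)
    (hSel : 1 < Nat.card (Wd.selmerGroup (3 : ℤ))) :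
    BSDp W 3 ∧ BSDp Wd 3 ∧ padicValNat 3 W.shaOrder = 0 := by
  obtain ⟨⟨hD, hE0⟩, hE⟩ := bsdp_twist_and_bsdp_of_indexBound_of_one_lt_card_selmerGroup_twist W 3
    hCT hGZK hKo hB hK hH hP hnt (by norm_num) hsurj hI Wd hWd hrd hqd hvd (by exact_mod_cast hSel)
  exact ⟨hE hr q hq hv, hD, hE0⟩

end Summit.BirchSwinnertonDyer.Rank1Residual.AdditiveThree

end
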